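import Literature.NumberTheory.IwasawaTheory.Greenberg2006.InducedCohomologyComparison
import Literature.NumberTheory.GaloisRepresentations.ShapiroVanishing
import Literature.NumberTheory.GaloisRepresentations.ContinuousCohomologyRestrictScalars
import Literature.NumberTheory.EllipticCurves.BigRepModuleShapiroInjectiveProofs
import Literature.GroupTheory.ProfiniteSubquotients
import Mathlib.NumberTheory.Padics.ProperSpace
import HarnessLib

/-!
# Greenberg 2006, Theorem 3 in vanishing form, PROVED for the twist deformation:
# `H²(K_S/K̃_∞, D) = 0 ⇒ H²(K_S/K, Ind_{K̃_∞/K}(D)) = 0` (Shapiro), without the named fact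

Topic `NumberTheory/IwasawaTheory/Greenberg2006`; namespace
`Literature.NumberTheory.IwasawaTheory.Greenberg2006`. Definitions with bodies (the model
isomorphism between the tree's curried co-induced module `IndModule₂` and Serre's induced module
`M_G^H(A)`) and theorems; NO named fact, no `sorry`, no instance, no notation.

WHY (cell `bsd-eis` RULING L68 (1), ARM P sheet `pub/bsd-cited/sheets/D-AUDIT-r13-S15-Gr06Thm3Shapiro.md`
§3 DOOR): the named print fact `Greenberg2006.thm3_twistDeformation_cohomology_addEquiv`
(`InducedCohomologyComparison.lean`, [Gr4] Thm 3 = Shapiro's lemma, proof [Lim12] Prop 5.2.2) is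
consumed by road «Sh» only through its reader `.subsingleton` in degree `2`
(`Theorems/EisensteinPrimesTwistDeformationFullAtSelmerOfFacts.lean` :173). The analytic heart —
Faddeev–Shapiro for a CLOSED subgroup of a profinite group and a DISCRETE module — is a TREE
THEOREM in Serre's model (`ShapiroVanishing.subsingleton_coindRep_of_subsingleton`); this file
supplies the plumbing and proves the degree-2 (and degree-1) vanishing transfer for Greenberg's
`𝐃 = twistDeformation S hS κ₁ κ₂ ρ₀` UNCONDITIONALLY:

* §1 `IndModule₂.ofContinuous₂` — a continuous `ℤ_p × ℤ_p → A` (`A` discrete `p`-primary) IS an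
  element of `𝐃` (uniform levels from `BigRepModule.exists_isSmoothOfLevel_of_continuous`,
  `BigRepModuleShapiroInjectiveProofs.lean`, applied twice — the outer one through the discrete
  space `C(ℤ_p, A)`);
* §2 the tower subgroup `H = Gal(K_S/K̃_∞) = galoisGroupAbove S (multiZpKer p ![κ₁,κ₂])`: membership
  = joint kernel of the descended characters, the projection `g ↦ −κ̄(g) : G_{K,S} ↠ ℤ_p²`
  (closedness of `H` and profiniteness of `G_{K,S}` as private helpers; public versions are in
  `TwistDeformationLEO.lean` §1, which lives downstream of the named fact and is not imported);
* §3 the MODEL ISOMORPHISM `shapiroEquiv : 𝐃 ≃+ M_G^H(A)`, `Φ ↦ (g ↦ ρ₀(g)(Φ(−κ̄₁g)(−κ̄₂g)))`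
  (Greenberg's `ρ₀ ⊗ κ⁻¹` ↔ Serre's right translation), `G_{K,S}`-equivariant
  (`shapiroMap_twistDeformation`, `shapiroEquiv_symm_coindRep`);
* §4 vanishing of `H¹`/`H²` passes along a continuous equivariant additive retraction between
  topological representations over two DIFFERENT coefficient rings (cocycle criteria of
  `ContinuousCohomologyRestrictScalars`; here `ℤ` for Serre's model vs `Λ₂` for `𝐃`);
* §5 `twistDeformation_H_two_subsingleton_of_subsingleton_above` (and `…_H_one_…`): the transfer,
  from `ContinuousCohomologyRestrictScalars` (`𝒪 ↝ ℤ` on `H`) + `ShapiroVanishing` + §3–§4.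

References: [Greenberg2006] Thm 3 p. 342 L13–14; Serre, *Galois Cohomology* I §2.5 Prop 10;
[Lim2012PoitouTate] Prop 5.2.2 (the Λ-linear form, not needed here).
-/

noncomputable section

open scoped Classical
open NumberField IsDedekindDomain Field CategoryTheory
open Literature.NumberTheory.GaloisRepresentations
open Literature.NumberTheory.EllipticCurves (ZpExtension IsSmoothOfLevel BigRepModule bigRepSubmodule)
open Literature.NumberTheory.EllipticCurves.BigRepModule (continuous_coe exists_isSmoothOfLevel_of_continuous
  exists_uniform_pow_smul_eq_zero)
open Literature.NumberTheory.IwasawaTheory.Greenberg2016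

namespace Literature.NumberTheory.IwasawaTheory.Greenberg2006

/-! ## §1. `𝐃` receives continuous functions on `ℤ_p²` -/

section Level

variable {p : ℕ} [Fact p.Prime] {𝒪 : Type*} [CommRing 𝒪] {A : Type*} [AddCommGroup A] [Module 𝒪 A]
  [TopologicalSpace A] [DiscreteTopology A]

/-- Evaluation `(Φ, x) ↦ Φ x` on the module of smooth functions is jointly continuous (the module
is discrete and each `Φ` is locally constant, `BigRepModule.continuous_coe`). [folklore] -/
private theorem continuous_bigRepModule_eval₂ :
    Continuous fun q : BigRepModule 𝒪 p A × ℤ_[p] ↦ (q.1 : ℤ_[p] → A) q.2 :=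
  continuous_prod_of_discrete_left.mpr fun Φ ↦ continuous_coe Φ

/-- A continuous function on `ℤ_p²` with values in a discrete `p`-primary module is UNIFORMLY
`p`-power-torsion (finite range, `BigRepModule.exists_uniform_pow_smul_eq_zero`). [folklore] -/
private theorem exists_uniform_pow_smul_eq_zero₂ (F : ℤ_[p] × ℤ_[p] → A) (hF : Continuous F)
    (hA : ∀ a : A, ∃ n : ℕ, (p ^ n : ℤ) • a = 0) : ∃ k : ℕ, ∀ z, p ^ k • F z = 0 :=
  exists_uniform_pow_smul_eq_zero (isCompact_range hF).finite_of_discrete fun z ↦ by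
    obtain ⟨k, hk⟩ := hA (F z)
    exact ⟨k, by rw [← natCast_zsmul]; exact_mod_cast hk⟩

/-- The partial functions `y ↦ F(x, y)` of a continuous `F : ℤ_p² → A` are smooth `p`-primary
(uniform level from `BigRepModule.exists_isSmoothOfLevel_of_continuous`). [folklore] -/
private theorem IndModule₂.ofContinuous₂_mem_inner (F : ℤ_[p] × ℤ_[p] → A) (hF : Continuous F)
    (hA : ∀ a : A, ∃ n : ℕ, (p ^ n : ℤ) • a = 0) (x : ℤ_[p]) :
    (fun y ↦ F (x, y)) ∈ bigRepSubmodule 𝒪 p A := by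
  obtain ⟨k, hk⟩ := exists_uniform_pow_smul_eq_zero₂ F hF hA
  exact ⟨exists_isSmoothOfLevel_of_continuous (hF.comp (Continuous.prodMk_right x)),
    k, fun y ↦ hk (x, y)⟩

/-- The curried function `x ↦ (y ↦ F(x, y))` of a continuous `F : ℤ_p² → A` is a smooth `p`-primary
function into the inner module: its level is uniform because `x ↦ F(x, ·)` is continuous into the
DISCRETE space `C(ℤ_p, A)` (`ℤ_p` compact, `A` discrete). [folklore] -/
private theorem IndModule₂.ofContinuous₂_mem_outer (F : ℤ_[p] × ℤ_[p] → A) (hF : Continuous F)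
    (hA : ∀ a : A, ∃ n : ℕ, (p ^ n : ℤ) • a = 0) :
    (fun x ↦ BigRepModule.mk (fun y ↦ F (x, y)) (IndModule₂.ofContinuous₂_mem_inner F hF hA x)) ∈
      bigRepSubmodule (PowerSeries 𝒪) p (BigRepModule 𝒪 p A) := by
  obtain ⟨k, hk⟩ := exists_uniform_pow_smul_eq_zero₂ F hF hA
  haveI : DiscreteTopology C(ℤ_[p], A) := discreteTopology_continuousMap ℤ_[p] A
  obtain ⟨n, hn⟩ := exists_isSmoothOfLevel_of_continuous (ContinuousMap.curry ⟨F, hF⟩).continuous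
  refine ⟨⟨n, fun x x' hxx' ↦ BigRepModule.ext fun y ↦ ?_⟩, k, fun x ↦ BigRepModule.ext fun y ↦ ?_⟩
  · exact congrArg (fun f : C(ℤ_[p], A) ↦ f y) (hn x x' hxx')
  · rw [BigRepModule.nsmul_apply, BigRepModule.zero_apply]
    exact hk (x, y)

/-- **A continuous function `ℤ_p × ℤ_p → A` into a discrete `p`-primary module is an element of
`𝐃 = IndModule₂ 𝒪 p A`** (curried smooth `p`-power-torsion functions): the tree's `𝐃` is [Lim12]'s
`F_Γ(A)`, `Γ = ℤ_p²`, the locally constant `A`-valued functions on `Γ`.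
[cite: Lim2012PoitouTate, §5.1 p. 17 (`F_Γ(M) = lim→_U Hom_R(R[Γ/U], M)`, locally constant functions on `Γ`)] -/
def IndModule₂.ofContinuous₂ (F : ℤ_[p] × ℤ_[p] → A) (hF : Continuous F)
    (hA : ∀ a : A, ∃ n : ℕ, (p ^ n : ℤ) • a = 0) : IndModule₂ 𝒪 p A :=
  BigRepModule.mk _ (IndModule₂.ofContinuous₂_mem_outer F hF hA)

/-- Unfolding `IndModule₂.ofContinuous₂`: its values are those of `F`.
[cite: Lim2012PoitouTate, §5.1 p. 17 (`F_Γ(M) = lim→_U Hom_R(R[Γ/U], M)`, locally constant functions on `Γ`)] -/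
@[simp] theorem IndModule₂.ofContinuous₂_apply (F : ℤ_[p] × ℤ_[p] → A) (hF : Continuous F)
    (hA : ∀ a : A, ∃ n : ℕ, (p ^ n : ℤ) • a = 0) (x y : ℤ_[p]) :
    IndModule₂.ofContinuous₂ (𝒪 := 𝒪) F hF hA x y = F (x, y) := rfl

end Level

/-! ## §2. The tower subgroup `H = Gal(K_S/K̃_∞)` and the projection `G_{K,S} → ℤ_p²` -/

section Tower

variable {K : Type} [Field K] [NumberField K] (S : Set (HeightOneSpectrum (𝓞 K))) {p : ℕ} [Fact p.Prime]
  (hS : ∀ v : HeightOneSpectrum (𝓞 K), ((p : ℕ) : 𝓞 K) ∈ v.asIdeal → v ∈ S)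
  (κ₁ κ₂ : ZpExtension K p)

/-- Membership in `Gal(K_S/K̃_∞) ≤ G_{K,S}`: the joint kernel of the descended characters `κ̄₁, κ̄₂`.
[cite: Greenberg2006, p. 341 L39–45, p. 342 L2–4] -/
theorem mem_galoisGroupAbove_pair_iff (g : GaloisGroupUnramifiedOutside K S) :
    g ∈ galoisGroupAbove S (multiZpKer p ![κ₁, κ₂]) ↔
      κ₁.liftUnramifiedOutside S hS g = 1 ∧ κ₂.liftUnramifiedOutside S hS g = 1 := by
  constructor
  · intro hg
    obtain ⟨σ, hσ, rfl⟩ := (mem_galoisGroupAbove_iff S _ g).1 hg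
    rw [mem_multiZpKer_iff] at hσ
    exact ⟨hσ 0, hσ 1⟩
  · rintro ⟨h1, h2⟩
    obtain ⟨σ, rfl⟩ := toUnramifiedQuot_surjective K S g
    refine (mem_galoisGroupAbove_iff S _ _).2 ⟨σ, ?_, rfl⟩
    rw [mem_multiZpKer_iff]
    intro i
    fin_cases i
    · exact h1
    · exact h2

/-- `Gal(K_S/K̃_∞)` is closed in `G_{K,S}` (image of the closed, hence compact, `⋂ ker κᵢ ≤ Γ_K`).
Private copy of the special case `H = ⋂ ker κᵢ` of `TwistDeformationLEO.isClosed_galoisGroupAbove`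
(that file imports the named-fact consumer side and is not imported here).
[cite: Greenberg2006, p. 341 L39–47] -/
private theorem isClosed_galoisGroupAbove_pair :
    IsClosed ((galoisGroupAbove S (multiZpKer p ![κ₁, κ₂]) :
      Subgroup (GaloisGroupUnramifiedOutside K S)) : Set (GaloisGroupUnramifiedOutside K S)) := by
  rw [galoisGroupAbove, Subgroup.coe_map]
  exact ((isClosed_multiZpKer p ![κ₁, κ₂]).isCompact.image (continuous_toUnramifiedQuot K S)).isClosed

/-- `G_{K,S} = Γ_K ⧸ N_S` is totally disconnected (profinite: the quotient of a profinite group by a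
CLOSED normal subgroup, `ProfiniteSubquotients.totallyDisconnectedSpace_quotient`). A theorem, used
through `haveI` (no instance is declared in this file); private copy of
`TwistDeformationLEO.totallyDisconnectedSpace_galoisGroupUnramifiedOutside` (that file is not imported
here, see above). [cite: RibesZalesskii2010, Prop 2.2.1] -/
private theorem totallyDisconnected_galoisGroupUnramifiedOutside_aux :
    TotallyDisconnectedSpace (GaloisGroupUnramifiedOutside K S) :=
  Literature.GroupTheory.ProfiniteSubquotients.totallyDisconnectedSpace_quotient
    (ramificationSubgroup K S) (ramificationSubgroup_isClosed K S)

/-- The projection `g ↦ −κ̄(g) = (−κ̄₁ g, −κ̄₂ g) : G_{K,S} → ℤ_p²` (the sign is Greenberg's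
`ρ₀ ⊗ κ⁻¹`). [cite: Greenberg2006, p. 342 L2–6] -/
def towerProj (g : GaloisGroupUnramifiedOutside K S) : ℤ_[p] × ℤ_[p] :=
  (-(κ₁.liftUnramifiedOutside S hS g).toAdd, -(κ₂.liftUnramifiedOutside S hS g).toAdd)

/-- The projection `G_{K,S} → ℤ_p²` is continuous. [folklore] -/
private theorem continuous_towerProj : Continuous (towerProj S hS κ₁ κ₂) :=
  ((continuous_toAdd.comp (map_continuous _)).neg).prodMk
    ((continuous_toAdd.comp (map_continuous _)).neg)

/-- Under joint surjectivity of `(κ₁, κ₂)` on `Γ_K` the projection `Gal(K_Σ/K) → Γ = Gal(K_∞/K) ≅ ℤ_p²`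
is onto. [cite: Greenberg2006, p. 341 L24–27 (`Γ = Gal(K_∞/K) ≅ ℤ_p^m`)] -/
theorem towerProj_surjective
    (hκ : Function.Surjective fun σ : absoluteGaloisGroup K ↦ (κ₁ σ, κ₂ σ)) :
    Function.Surjective (towerProj S hS κ₁ κ₂) := by
  rintro ⟨x, y⟩
  obtain ⟨σ, hσ⟩ := hκ (Multiplicative.ofAdd (-x), Multiplicative.ofAdd (-y))
  simp only [Prod.mk.injEq] at hσ
  refine ⟨toUnramifiedQuot K S σ, ?_⟩
  change (-(κ₁ σ).toAdd, -(κ₂ σ).toAdd) = (x, y)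
  rw [hσ.1, hσ.2, toAdd_ofAdd, toAdd_ofAdd, neg_neg, neg_neg]

/-- Two elements with the same projection differ by an element of `H`. [folklore] -/
private theorem mul_inv_mem_of_towerProj_eq {g g' : GaloisGroupUnramifiedOutside K S}
    (h : towerProj S hS κ₁ κ₂ g = towerProj S hS κ₁ κ₂ g') :
    g' * g⁻¹ ∈ galoisGroupAbove S (multiZpKer p ![κ₁, κ₂]) := by
  simp only [towerProj, Prod.mk.injEq, neg_inj] at h
  have h1 : κ₁.liftUnramifiedOutside S hS g = κ₁.liftUnramifiedOutside S hS g' :=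
    Multiplicative.toAdd.injective h.1
  have h2 : κ₂.liftUnramifiedOutside S hS g = κ₂.liftUnramifiedOutside S hS g' :=
    Multiplicative.toAdd.injective h.2
  rw [mem_galoisGroupAbove_pair_iff S hS κ₁ κ₂]
  constructor
  · rw [map_mul, map_inv, ← h1, mul_inv_cancel]
  · rw [map_mul, map_inv, ← h2, mul_inv_cancel]

/-- The projection is a quotient map (continuous surjection from a compact space to a Hausdorff
space). [folklore] -/
private theorem isQuotientMap_towerProj
    (hκ : Function.Surjective fun σ : absoluteGaloisGroup K ↦ (κ₁ σ, κ₂ σ)) :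
    Topology.IsQuotientMap (towerProj S hS κ₁ κ₂) :=
  ((continuous_towerProj S hS κ₁ κ₂).isClosedMap).isQuotientMap (continuous_towerProj S hS κ₁ κ₂)
    (towerProj_surjective S hS κ₁ κ₂ hκ)

end Tower

/-! ## §3. The model isomorphism `𝐃 = IndModule₂ ≅ M_G^H(A)` (Greenberg's `ρ₀ ⊗ κ⁻¹` ↔ Serre's `M_G^H`) -/

section Model

variable {K : Type} [Field K] [NumberField K] (S : Set (HeightOneSpectrum (𝓞 K))) {p : ℕ} [Fact p.Prime]
  (hS : ∀ v : HeightOneSpectrum (𝓞 K), ((p : ℕ) : 𝓞 K) ∈ v.asIdeal → v ∈ S)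
  (κ₁ κ₂ : ZpExtension K p)
  {𝒪 : Type} [CommRing 𝒪] [TopologicalSpace 𝒪] {A : Type} [AddCommGroup A] [Module 𝒪 A]
  [TopologicalSpace A] [DiscreteTopology A]
  (ρ₀ : ContinuousRep (GaloisGroupUnramifiedOutside K S) 𝒪 A)

/-- `σ := ρ₀|_H` viewed over `ℤ`, the discrete `H`-module `D = A` of Serre's `M_G^H(A)`
(`H = Gal(K_S/K̃_∞)`). [cite: Greenberg2006, p. 341 L12–16] -/
abbrev towerRep : ContinuousRep (galoisGroupAbove S (multiZpKer p ![κ₁, κ₂])) ℤ A :=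
  (ρ₀.restrict (galoisGroupAboveSubtype S (multiZpKer p ![κ₁, κ₂]))).restrictScalars ℤ

omit [NumberField K] [DiscreteTopology A] in
/-- Unfolding `towerRep`: it is `ρ₀` on the subgroup `Gal(K_Σ/K_∞)` ("`H^i(K_Σ/K_∞, D)`": `D` regarded
as a `Gal(K_Σ/K_∞)`-module by restriction). [cite: Greenberg2006, p. 341 L12–16] -/
@[simp] theorem towerRep_apply (s : galoisGroupAbove S (multiZpKer p ![κ₁, κ₂])) (a : A) :
    towerRep S κ₁ κ₂ ρ₀ s a = ρ₀ (s : GaloisGroupUnramifiedOutside K S) a := rfl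

/-- The function `a*_Φ : g ↦ ρ₀(g)(Φ(−κ̄₁ g)(−κ̄₂ g))` attached to `Φ ∈ 𝐃`, continuous (`A` discrete,
`Φ` locally constant, the action jointly continuous). [cite: Greenberg2006, p. 342 L5–11] -/
def shapiroFun (Φ : IndModule₂ 𝒪 p A) : C(GaloisGroupUnramifiedOutside K S, A) where
  toFun g := ρ₀ g (Φ (towerProj S hS κ₁ κ₂ g).1 (towerProj S hS κ₁ κ₂ g).2)
  continuous_toFun := by
    have h1 : Continuous fun g : GaloisGroupUnramifiedOutside K S ↦
        (Φ (towerProj S hS κ₁ κ₂ g).1 : BigRepModule 𝒪 p A) :=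
      (continuous_coe Φ).comp (continuous_fst.comp (continuous_towerProj S hS κ₁ κ₂))
    have h2 : Continuous fun g : GaloisGroupUnramifiedOutside K S ↦ (towerProj S hS κ₁ κ₂ g).2 :=
      continuous_snd.comp (continuous_towerProj S hS κ₁ κ₂)
    have hc : Continuous fun g : GaloisGroupUnramifiedOutside K S ↦
        (Φ (towerProj S hS κ₁ κ₂ g).1 : ℤ_[p] → A) (towerProj S hS κ₁ κ₂ g).2 :=
      continuous_bigRepModule_eval₂.comp (h1.prodMk h2)
    exact ρ₀.continuous_smul.comp (continuous_id.prodMk hc)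

/-- Unfolding `shapiroFun`. [folklore] -/
@[simp] private theorem shapiroFun_apply (Φ : IndModule₂ 𝒪 p A) (g : GaloisGroupUnramifiedOutside K S) :
    shapiroFun S hS κ₁ κ₂ ρ₀ Φ g =
      ρ₀ g (Φ (-(κ₁.liftUnramifiedOutside S hS g).toAdd) (-(κ₂.liftUnramifiedOutside S hS g).toAdd)) :=
  rfl

/-- `a*_Φ` lies in Serre's induced module: `a*(s g) = s · a*(g)` for `s ∈ H` (`κ̄(s) = 0`).
[cite: SerreGaloisCohomology1997, I §2.5] -/
theorem shapiroFun_mem (Φ : IndModule₂ 𝒪 p A) :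
    shapiroFun S hS κ₁ κ₂ ρ₀ Φ ∈ coindModule (towerRep S κ₁ κ₂ ρ₀) := by
  rw [mem_coind_iff]
  intro s x
  obtain ⟨hs1, hs2⟩ := (mem_galoisGroupAbove_pair_iff S hS κ₁ κ₂ (s : GaloisGroupUnramifiedOutside K S)).1 s.2
  rw [shapiroFun_apply, shapiroFun_apply, towerRep_apply]
  simp only [map_mul, hs1, hs2, one_mul, Module.End.mul_apply]

/-- **The Shapiro map `𝐃 → M_G^H(A)`, `Φ ↦ a*_Φ`** (additive). [cite: Greenberg2006, Thm 3 p. 342] -/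
def shapiroMap : IndModule₂ 𝒪 p A →+ coindModule (towerRep S κ₁ κ₂ ρ₀) where
  toFun Φ := ⟨shapiroFun S hS κ₁ κ₂ ρ₀ Φ, shapiroFun_mem S hS κ₁ κ₂ ρ₀ Φ⟩
  map_zero' := by
    apply Subtype.ext
    ext g
    simp [shapiroFun_apply]
  map_add' Φ Ψ := by
    apply Subtype.ext
    ext g
    simp [shapiroFun_apply, map_add]

/-- Unfolding the Shapiro map: `a*_Φ(g) = ρ₀(g)(Φ(−κ̄₁ g)(−κ̄₂ g))` (Greenberg's `ρ = ρ₀ ⊗ κ⁻¹` read in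
Serre's `M_G^H(A)`). [cite: Greenberg2006, p. 342 L5–6] [cite: SerreGaloisCohomology1997, I §2.5] -/
@[simp] theorem shapiroMap_apply_apply (Φ : IndModule₂ 𝒪 p A) (g : GaloisGroupUnramifiedOutside K S) :
    ((shapiroMap S hS κ₁ κ₂ ρ₀ Φ : coindModule (towerRep S κ₁ κ₂ ρ₀)) : C(_, A)) g =
      ρ₀ g (Φ (-(κ₁.liftUnramifiedOutside S hS g).toAdd) (-(κ₂.liftUnramifiedOutside S hS g).toAdd)) :=
  rfl

/-- The Shapiro map is injective when `(κ₁, κ₂)` is jointly onto `ℤ_p²` (half of "`𝒟 = Ind_{K_∞/K}(D)`":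
Greenberg's `𝒟` IS the induced module). [cite: Greenberg2006, p. 342 L8–11 (`𝒟 = Ind_{K_∞/K}(D)`)]
[cite: Lim2012PoitouTate, §5.1 p. 17 (`F_Γ(M) = lim→_U Hom_R(R[Γ/U], M)`, locally constant functions on `Γ`)] -/
theorem shapiroMap_injective
    (hκ : Function.Surjective fun σ : absoluteGaloisGroup K ↦ (κ₁ σ, κ₂ σ)) :
    Function.Injective (shapiroMap S hS κ₁ κ₂ ρ₀) := by
  rw [injective_iff_map_eq_zero]
  intro Φ hΦ
  apply BigRepModule.ext
  intro x
  apply BigRepModule.ext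
  intro y
  obtain ⟨g, hg⟩ := towerProj_surjective S hS κ₁ κ₂ hκ (x, y)
  have h := congrArg (fun F : coindModule (towerRep S κ₁ κ₂ ρ₀) ↦ (F : C(_, A)) g) hΦ
  simp only [shapiroMap_apply_apply, Submodule.coe_zero, ContinuousMap.zero_apply] at h
  simp only [towerProj, Prod.mk.injEq] at hg
  rw [hg.1, hg.2] at h
  have : ρ₀ g⁻¹ (ρ₀ g (Φ x y)) = 0 := by rw [h, map_zero]
  rwa [← Module.End.mul_apply, ← map_mul, inv_mul_cancel, map_one, Module.End.one_apply] at this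

/-- The descended function of `a* ∈ M_G^H(A)`: `g ↦ ρ₀(g)⁻¹ a*(g)`, continuous and constant on
`H`-cosets. [folklore] -/
private def descFun (f : coindModule (towerRep S κ₁ κ₂ ρ₀)) : C(GaloisGroupUnramifiedOutside K S, A) where
  toFun g := ρ₀ g⁻¹ ((f : C(_, A)) g)
  continuous_toFun :=
    ρ₀.continuous_smul.comp (continuous_inv.prodMk (f : C(_, A)).continuous)

omit [NumberField K] in
/-- Unfolding `descFun`. [folklore] -/
private theorem descFun_apply (f : coindModule (towerRep S κ₁ κ₂ ρ₀)) (g : GaloisGroupUnramifiedOutside K S) :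
    descFun S κ₁ κ₂ ρ₀ f g = ρ₀ g⁻¹ ((f : C(_, A)) g) := rfl

/-- `descFun` is constant on the fibres of the projection `G_{K,S} → ℤ_p²` (the `H`-cosets):
`a*(g') = ρ₀(g' g⁻¹) a*(g)` for `g' g⁻¹ ∈ H`. [folklore] -/
private theorem descFun_eq_of_towerProj_eq (f : coindModule (towerRep S κ₁ κ₂ ρ₀))
    {g g' : GaloisGroupUnramifiedOutside K S}
    (h : towerProj S hS κ₁ κ₂ g = towerProj S hS κ₁ κ₂ g') :
    descFun S κ₁ κ₂ ρ₀ f g = descFun S κ₁ κ₂ ρ₀ f g' := by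
  have hmem := mul_inv_mem_of_towerProj_eq S hS κ₁ κ₂ h
  have hf := (mem_coind_iff (towerRep S κ₁ κ₂ ρ₀) _).1 f.2 ⟨g' * g⁻¹, hmem⟩ g
  -- `a*(g') = a*((g' g⁻¹) g) = ρ₀(g' g⁻¹) a*(g)`
  rw [descFun_apply, descFun_apply]
  have hg' : (⟨g' * g⁻¹, hmem⟩ : galoisGroupAbove S (multiZpKer p ![κ₁, κ₂])) * g = g' := by
    change g' * g⁻¹ * g = g'
    rw [inv_mul_cancel_right]
  rw [hg'] at hf
  rw [hf, towerRep_apply, ← Module.End.mul_apply, ← map_mul]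
  change _ = ρ₀ (g'⁻¹ * (g' * g⁻¹)) _
  rw [inv_mul_cancel_left]

/-- The function on `ℤ_p²` underlying the inverse image of `a*`: `F(−κ̄ g) = ρ₀(g)⁻¹ a*(g)`.
[folklore] -/
private def descFun₂ (hκ : Function.Surjective fun σ : absoluteGaloisGroup K ↦ (κ₁ σ, κ₂ σ))
    (f : coindModule (towerRep S κ₁ κ₂ ρ₀)) : ℤ_[p] × ℤ_[p] → A :=
  fun z ↦ descFun S κ₁ κ₂ ρ₀ f (Function.surjInv (towerProj_surjective S hS κ₁ κ₂ hκ) z)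

/-- `descFun₂ ∘ towerProj = descFun`. [folklore] -/
private theorem descFun₂_towerProj (hκ : Function.Surjective fun σ : absoluteGaloisGroup K ↦ (κ₁ σ, κ₂ σ))
    (f : coindModule (towerRep S κ₁ κ₂ ρ₀)) (g : GaloisGroupUnramifiedOutside K S) :
    descFun₂ S hS κ₁ κ₂ ρ₀ hκ f (towerProj S hS κ₁ κ₂ g) = descFun S κ₁ κ₂ ρ₀ f g :=
  descFun_eq_of_towerProj_eq S hS κ₁ κ₂ ρ₀ f
    (Function.surjInv_eq (towerProj_surjective S hS κ₁ κ₂ hκ) _)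

/-- `descFun₂` is continuous (the projection is a quotient map). [folklore] -/
private theorem continuous_descFun₂ (hκ : Function.Surjective fun σ : absoluteGaloisGroup K ↦ (κ₁ σ, κ₂ σ))
    (f : coindModule (towerRep S κ₁ κ₂ ρ₀)) : Continuous (descFun₂ S hS κ₁ κ₂ ρ₀ hκ f) := by
  rw [(isQuotientMap_towerProj S hS κ₁ κ₂ hκ).continuous_iff]
  have : descFun₂ S hS κ₁ κ₂ ρ₀ hκ f ∘ towerProj S hS κ₁ κ₂ = descFun S κ₁ κ₂ ρ₀ f :=
    funext fun g ↦ descFun₂_towerProj S hS κ₁ κ₂ ρ₀ hκ f g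
  rw [this]
  exact (descFun S κ₁ κ₂ ρ₀ f).continuous

/-- The Shapiro map is surjective when `A` is `p`-primary and `(κ₁, κ₂)` jointly onto: `a*` is the
image of the curried smooth function `F(−κ̄ g) = ρ₀(g)⁻¹ a*(g)` (`IndModule₂.ofContinuous₂`) — the other
half of "`𝒟 = Ind_{K_∞/K}(D)`". [cite: Greenberg2006, p. 342 L8–11 (`𝒟 = Ind_{K_∞/K}(D)`)]
[cite: Lim2012PoitouTate, §5.1 p. 17 (`F_Γ(M) = lim→_U Hom_R(R[Γ/U], M)`, locally constant functions on `Γ`)] -/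
theorem shapiroMap_surjective
    (hκ : Function.Surjective fun σ : absoluteGaloisGroup K ↦ (κ₁ σ, κ₂ σ))
    (hA : ∀ a : A, ∃ n : ℕ, (p ^ n : ℤ) • a = 0) :
    Function.Surjective (shapiroMap S hS κ₁ κ₂ ρ₀) := by
  intro f
  refine ⟨IndModule₂.ofContinuous₂ (descFun₂ S hS κ₁ κ₂ ρ₀ hκ f)
    (continuous_descFun₂ S hS κ₁ κ₂ ρ₀ hκ f) hA, ?_⟩
  apply Subtype.ext
  ext g
  rw [shapiroMap_apply_apply]
  change ρ₀ g (IndModule₂.ofContinuous₂ _ _ hA (towerProj S hS κ₁ κ₂ g).1 (towerProj S hS κ₁ κ₂ g).2) = _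
  rw [IndModule₂.ofContinuous₂_apply, Prod.mk.eta, descFun₂_towerProj, descFun_apply,
    ← Module.End.mul_apply, ← map_mul, mul_inv_cancel, map_one, Module.End.one_apply]

/-- **The model isomorphism `𝐃 ≃ M_G^H(A)`** (additive). [cite: Greenberg2006, Thm 3 p. 342] -/
def shapiroEquiv (hκ : Function.Surjective fun σ : absoluteGaloisGroup K ↦ (κ₁ σ, κ₂ σ))
    (hA : ∀ a : A, ∃ n : ℕ, (p ^ n : ℤ) • a = 0) :
    IndModule₂ 𝒪 p A ≃+ coindModule (towerRep S κ₁ κ₂ ρ₀) :=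
  AddEquiv.ofBijective (shapiroMap S hS κ₁ κ₂ ρ₀)
    ⟨shapiroMap_injective S hS κ₁ κ₂ ρ₀ hκ, shapiroMap_surjective S hS κ₁ κ₂ ρ₀ hκ hA⟩

/-- Unfolding `shapiroEquiv`: it is the Shapiro map. [cite: Greenberg2006, Thm 3 p. 342] -/
@[simp] theorem shapiroEquiv_apply (hκ : Function.Surjective fun σ : absoluteGaloisGroup K ↦ (κ₁ σ, κ₂ σ))
    (hA : ∀ a : A, ∃ n : ℕ, (p ^ n : ℤ) • a = 0) (Φ : IndModule₂ 𝒪 p A) :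
    shapiroEquiv S hS κ₁ κ₂ ρ₀ hκ hA Φ = shapiroMap S hS κ₁ κ₂ ρ₀ Φ := rfl

variable [TopologicalSpace (PowerSeries 𝒪)] [TopologicalSpace (PowerSeries (PowerSeries 𝒪))]

/-- **Equivariance**: the Shapiro map intertwines Greenberg's action `ρ₀ ⊗ κ⁻¹` on `𝐃` with Serre's
right translation on `M_G^H(A)`. [cite: Greenberg2006, p. 342 L5–6] [cite: SerreGaloisCohomology1997, I §2.5] -/
theorem shapiroMap_twistDeformation (g : GaloisGroupUnramifiedOutside K S) (Φ : IndModule₂ 𝒪 p A) :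
    shapiroMap S hS κ₁ κ₂ ρ₀ (twistDeformation S hS κ₁ κ₂ ρ₀ g Φ) =
      coindRep (towerRep S κ₁ κ₂ ρ₀) g (shapiroMap S hS κ₁ κ₂ ρ₀ Φ) := by
  apply Subtype.ext
  ext x
  rw [coindRep_apply_apply, shapiroMap_apply_apply, shapiroMap_apply_apply, twistDeformation_apply]
  simp only [map_mul, toAdd_mul, neg_add, Module.End.mul_apply, sub_eq_add_neg]

end Model

/-! ## §4. Vanishing transport along an equivariant additive retraction (any two coefficient rings) -/

section Transport

variable {R : Type*} [CommRing R] [TopologicalSpace R] {R' : Type*} [CommRing R'] [TopologicalSpace R']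
  {G : Type} [Group G] [TopologicalSpace G] [IsTopologicalGroup G]
  {X : TopRep.{0} R G} {Y : TopRep.{0} R' G}
  (e : X →+ Y) (hρ : ∀ (g : G) (x : X), e (X.ρ g x) = Y.ρ g (e x))
  (e' : Y →+ X) (he' : Continuous e') (hρ' : ∀ (g : G) (y : Y), e' (Y.ρ g y) = X.ρ g (e' y))
  (hee' : ∀ y : Y, e (e' y) = y)
include hρ he' hρ' hee'

/-- **`H¹` vanishing passes along a continuous equivariant additive retraction `e ∘ e' = id`**, the two
topological representations living over ANY two coefficient rings (continuous cohomology does not see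
the scalars: a continuous crossed homomorphism to `Y` is pushed to `X` by `e'`, split there, and the
splitting element pushed back by `e`, whose continuity is not even needed in degree `1`).
[cite: SerreGaloisCohomology1997, I §2.2] -/
theorem subsingleton_continuousCohomology_one_of_addMonoidHom_retraction
    (hX : Subsingleton (continuousCohomology 1 X)) : Subsingleton (continuousCohomology 1 Y) := by
  rw [subsingleton_continuousCohomology_one_iff_forall_oneCocycle] at hX ⊢
  intro φ hφ
  obtain ⟨v, hv⟩ := hX ⟨fun g ↦ e' (φ g), he'.comp φ.continuous⟩ fun g h ↦ by
    change e' (φ (g * h)) = e' (φ g) + X.ρ g (e' (φ h))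
    rw [← hρ', ← map_add, hφ]
  refine ⟨e v, fun g ↦ ?_⟩
  rw [← hee' (φ g), ← hρ, ← map_sub]
  exact congrArg e (hv g)

variable [LocallyCompactSpace G]

/-- **`H²` vanishing passes along a continuous equivariant additive retraction `e ∘ e' = id`**, over
any two coefficient rings (continuous inhomogeneous `2`-cocycles and coboundaries are additive
notions). [cite: SerreGaloisCohomology1997, I §2.3] -/
theorem subsingleton_continuousCohomology_two_of_addMonoidHom_retraction (he : Continuous e)
    (hX : Subsingleton (continuousCohomology 2 X)) : Subsingleton (continuousCohomology 2 Y) := by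
  rw [subsingleton_continuousCohomology_two_iff_forall_twoCocycle] at hX ⊢
  intro f hf
  obtain ⟨b, hb⟩ := hX ⟨fun q ↦ e' (f q), he'.comp f.continuous⟩ fun σ τ υ ↦ by
    change X.ρ σ (e' (f (τ, υ))) + e' (f (σ, τ * υ)) = e' (f (σ * τ, υ)) + e' (f (σ, τ))
    rw [← hρ', ← map_add, ← map_add, hf]
  refine ⟨⟨fun σ ↦ e (b σ), he.comp b.continuous⟩, fun σ τ ↦ ?_⟩
  change f (σ, τ) = Y.ρ σ (e (b τ)) - e (b (σ * τ)) + e (b σ)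
  rw [← hee' (f (σ, τ)), ← hρ, ← map_sub, ← map_add]
  exact congrArg e (hb σ τ)

end Transport

/-! ## §5. Shapiro for `𝐃`: the vanishing transfer, PROVED (degrees `2` and `1`) -/

section Transfer

variable {K : Type} [Field K] [NumberField K] {S : Set (HeightOneSpectrum (𝓞 K))} {p : ℕ}
  [Fact p.Prime]
  (hS : ∀ v : HeightOneSpectrum (𝓞 K), ((p : ℕ) : 𝓞 K) ∈ v.asIdeal → v ∈ S)
  (κ₁ κ₂ : ZpExtension K p)
  (hκ : Function.Surjective fun σ : absoluteGaloisGroup K ↦ (κ₁ σ, κ₂ σ))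
  {𝒪 : Type} [CommRing 𝒪] [TopologicalSpace 𝒪] [TopologicalSpace (PowerSeries 𝒪)]
  [TopologicalSpace (PowerSeries (PowerSeries 𝒪))]
  {A : Type} [AddCommGroup A] [Module 𝒪 A] [TopologicalSpace A] [DiscreteTopology A]
  (ρ₀ : ContinuousRep (GaloisGroupUnramifiedOutside K S) 𝒪 A)
  (hA : ∀ a : A, ∃ n : ℕ, (p ^ n : ℤ) • a = 0)

/-- Equivariance of the INVERSE model isomorphism `M_G^H(A) → 𝐃`. [cite: Greenberg2006, Thm 3 p. 342] -/
theorem shapiroEquiv_symm_coindRep (g : GaloisGroupUnramifiedOutside K S)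
    (f : coindModule (towerRep S κ₁ κ₂ ρ₀)) :
    (shapiroEquiv S hS κ₁ κ₂ ρ₀ hκ hA).symm (coindRep (towerRep S κ₁ κ₂ ρ₀) g f) =
      twistDeformation S hS κ₁ κ₂ ρ₀ g ((shapiroEquiv S hS κ₁ κ₂ ρ₀ hκ hA).symm f) := by
  apply (shapiroEquiv S hS κ₁ κ₂ ρ₀ hκ hA).injective
  rw [AddEquiv.apply_symm_apply, shapiroEquiv_apply, shapiroMap_twistDeformation,
    ← shapiroEquiv_apply S hS κ₁ κ₂ ρ₀ hκ hA, AddEquiv.apply_symm_apply]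

variable [ContinuousSMul 𝒪 A] [ContinuousSMul (PowerSeries (PowerSeries 𝒪)) (IndModule₂ 𝒪 p A)]

include hκ hA

/-- **Greenberg 2006, Theorem 3 in vanishing form, degree 2, PROVED: if `H²(K_S/K̃_∞, D) = 0` then
`H²(K_S/K, 𝐃) = 0`** for `𝐃 = twistDeformation S hS κ₁ κ₂ ρ₀ = Ind_{K̃_∞/K}(D)`, `D = (A, ρ₀)` any
discrete `p`-primary `𝒪`-module with a continuous `𝒪`-linear `G_{K,S}`-action and `(κ₁, κ₂)` jointly
onto `ℤ_p²`. Chain: `𝒪 ↝ ℤ` on `H` (`ContinuousCohomologyRestrictScalars`) ∘ Faddeev–Shapiro for the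
CLOSED subgroup `H = Gal(K_S/K̃_∞)` of the profinite `G_{K,S}` in Serre's model (`ShapiroVanishing`) ∘
transport along the model isomorphism `shapiroEquiv : 𝐃 ≃ M_G^H(A)` (`ℤ ↝ Λ₂`, §4). This is the
consumer-facing form of the reader `thm3_twistDeformation_cohomology_addEquiv.subsingleton` at `i = 2`
WITHOUT the named-fact binder (and without `S.Finite`, not needed for vanishing).
[cite: Greenberg2006, Thm 3 p. 342 L13–14] [cite: SerreGaloisCohomology1997, I §2.5 Prop. 10] -/
theorem twistDeformation_H_two_subsingleton_of_subsingleton_above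
    (hH : Subsingleton ((ρ₀.restrict (galoisGroupAboveSubtype S (multiZpKer p ![κ₁, κ₂]))).H 2)) :
    Subsingleton ((twistDeformation S hS κ₁ κ₂ ρ₀).H 2) := by
  haveI : IsClosed ((galoisGroupAbove S (multiZpKer p ![κ₁, κ₂]) :
      Subgroup (GaloisGroupUnramifiedOutside K S)) : Set (GaloisGroupUnramifiedOutside K S)) :=
    isClosed_galoisGroupAbove_pair S κ₁ κ₂
  haveI : TotallyDisconnectedSpace (GaloisGroupUnramifiedOutside K S) :=
    totallyDisconnected_galoisGroupUnramifiedOutside_aux S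
  haveI : CompactSpace (galoisGroupAbove S (multiZpKer p ![κ₁, κ₂])) :=
    compactSpace_of_isClosed_subgroup
  haveI : DiscreteTopology (coindModule (towerRep S κ₁ κ₂ ρ₀)) := discreteTopology_coind _
  -- (1) `H²(H, D) = 0` over `𝒪` ⇒ over `ℤ`
  have h1 : Subsingleton (continuousCohomology 2 (towerRep S κ₁ κ₂ ρ₀).toTopRep) :=
    (ContinuousRep.subsingleton_H_two_restrictScalars_iff ℤ
      (ρ₀.restrict (galoisGroupAboveSubtype S (multiZpKer p ![κ₁, κ₂])))).2 hH
  -- (2) Faddeev–Shapiro in Serre's model: `H²(G_{K,S}, M_G^H(D)) = 0`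
  have h2 : Subsingleton (continuousCohomology 2 (coindRep (towerRep S κ₁ κ₂ ρ₀)).toTopRep) :=
    subsingleton_coindRep_of_subsingleton 1 (towerRep S κ₁ κ₂ ρ₀) h1
  -- (3) transport along `M_G^H(D) ≃ 𝐃` (over `ℤ`, resp. `Λ₂`)
  exact subsingleton_continuousCohomology_two_of_addMonoidHom_retraction
    (X := (coindRep (towerRep S κ₁ κ₂ ρ₀)).toTopRep) (Y := (twistDeformation S hS κ₁ κ₂ ρ₀).toTopRep)
    ((shapiroEquiv S hS κ₁ κ₂ ρ₀ hκ hA).symm : coindModule (towerRep S κ₁ κ₂ ρ₀) →+ IndModule₂ 𝒪 p A)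
    (fun g f ↦ shapiroEquiv_symm_coindRep hS κ₁ κ₂ hκ ρ₀ hA g f)
    (shapiroMap S hS κ₁ κ₂ ρ₀) continuous_of_discreteTopology
    (fun g Φ ↦ shapiroMap_twistDeformation S hS κ₁ κ₂ ρ₀ g Φ)
    (fun Φ ↦ (shapiroEquiv S hS κ₁ κ₂ ρ₀ hκ hA).symm_apply_apply Φ) continuous_of_discreteTopology h2

/-- The same transfer in degree `1`: `H¹(K_S/K̃_∞, D) = 0 ⇒ H¹(K_S/K, 𝐃) = 0`.
[cite: Greenberg2006, Thm 3 p. 342 L13–14] [cite: SerreGaloisCohomology1997, I §2.5 Prop. 10] -/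
theorem twistDeformation_H_one_subsingleton_of_subsingleton_above
    (hH : Subsingleton ((ρ₀.restrict (galoisGroupAboveSubtype S (multiZpKer p ![κ₁, κ₂]))).H 1)) :
    Subsingleton ((twistDeformation S hS κ₁ κ₂ ρ₀).H 1) := by
  haveI : IsClosed ((galoisGroupAbove S (multiZpKer p ![κ₁, κ₂]) :
      Subgroup (GaloisGroupUnramifiedOutside K S)) : Set (GaloisGroupUnramifiedOutside K S)) :=
    isClosed_galoisGroupAbove_pair S κ₁ κ₂
  haveI : TotallyDisconnectedSpace (GaloisGroupUnramifiedOutside K S) :=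
    totallyDisconnected_galoisGroupUnramifiedOutside_aux S
  haveI : CompactSpace (galoisGroupAbove S (multiZpKer p ![κ₁, κ₂])) :=
    compactSpace_of_isClosed_subgroup
  haveI : DiscreteTopology (coindModule (towerRep S κ₁ κ₂ ρ₀)) := discreteTopology_coind _
  have h1 : Subsingleton (continuousCohomology 1 (towerRep S κ₁ κ₂ ρ₀).toTopRep) :=
    (ContinuousRep.subsingleton_H_one_restrictScalars_iff ℤ
      (ρ₀.restrict (galoisGroupAboveSubtype S (multiZpKer p ![κ₁, κ₂])))).2 hH
  have h2 : Subsingleton (continuousCohomology 1 (coindRep (towerRep S κ₁ κ₂ ρ₀)).toTopRep) :=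
    subsingleton_coindRep_of_subsingleton 0 (towerRep S κ₁ κ₂ ρ₀) h1
  exact subsingleton_continuousCohomology_one_of_addMonoidHom_retraction
    (X := (coindRep (towerRep S κ₁ κ₂ ρ₀)).toTopRep) (Y := (twistDeformation S hS κ₁ κ₂ ρ₀).toTopRep)
    ((shapiroEquiv S hS κ₁ κ₂ ρ₀ hκ hA).symm : coindModule (towerRep S κ₁ κ₂ ρ₀) →+ IndModule₂ 𝒪 p A)
    (fun g f ↦ shapiroEquiv_symm_coindRep hS κ₁ κ₂ hκ ρ₀ hA g f)
    (shapiroMap S hS κ₁ κ₂ ρ₀) continuous_of_discreteTopology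
    (fun g Φ ↦ shapiroMap_twistDeformation S hS κ₁ κ₂ ρ₀ g Φ)
    (fun Φ ↦ (shapiroEquiv S hS κ₁ κ₂ ρ₀ hκ hA).symm_apply_apply Φ) h2

-- TODO(general form): all degrees `i` and the comparison `Hⁱ(K_S/K, 𝐃) ≃+ Hⁱ(K_S/K̃_∞, D)` itself
-- (`thm3_twistDeformation_cohomology_addEquiv_holds`), which needs the injectivity half
-- (`ShapiroInjective`) packaged as an explicit inverse pair and a cochain-level comparison in all
-- degrees; and the `Λ₂`-linear form of [Gr4] Thm 3 / [Lim12] Prop. 5.2.2.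

end Transfer

end Literature.NumberTheory.IwasawaTheory.Greenberg2006

end
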